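import Summits.BirchSwinnertonDyer.BirchSwinnertonDyer.Theorems.SlopeDichotomyA2BetaExitDefs
import Summits.BirchSwinnertonDyer.BirchSwinnertonDyer.Theses.SlopeDichotomyA2
import Literature.NumberTheory.EllipticCurves.PadicSigmaThreeExistence
import Literature.NumberTheory.EllipticCurves.OverconvergentModularSymbolsWeightTwoEigenLift
import Literature.NumberTheory.EllipticCurves.Rank1Residual.ClassX1
import Literature.NumberTheory.EllipticCurves.ModularParametrizationBCDTProofs
import Literature.NumberTheory.EllipticCurves.PAdicLFunctionInterpolationHoldsProofs
import Literature.NumberTheory.EllipticCurves.PAdicLFunctionNeZeroProofs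
import HarnessLib

/-!
# Crux `DegenerateLocusA2` (route `SlopeDichotomyA2`, item stmt-BirchSwinnertonDyer-19086) by the
# β-EXIT in `L`-function currency: the composition over the landed critical-slope `p`-adic
# `L`-function, and the NON-VACUITY of the β-rider on corner A2

Support file (prover seat `bsd-schneider-i1-c2`, gen 11, holding the route's tenure; cell
`bsd-schneider-ideate`; `--supports stmt-BirchSwinnertonDyer-19086`). THEOREMS ONLY; no `sorry`; every
open input enters BY NAME; BSD is not advanced.

The definitions file `SlopeDichotomyA2BetaExitDefs` states the β-road of the route over the landed
definition items D5′ (`OverconvergentModularSymbolsWeightTwo[EigenLift]`) and D1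
(`CriticalSlopePAdicLFunction`) WITHOUT the critical-slope height `h_β` (definition items D2/D3 are
blocked): the β-RIDER `HasBetaOrderOne W p` ("`L_p(f_β,T)` of the Pollack–Stevens eigen-lift has a
simple zero at `T = 0`") and the two crux statements `BetaOrderOneOnDegenerateA2` (S_β2: the rider
holds on the α-degenerate pairs of corner A2) and `BSDpOfBetaOrderOneA2` (S_β3: on corner A2 the
rider gives `BSD(E,p)` — the β-twin of the kernel theorem `X1.bsdp_of_typeBRankOne_of_schneider`).
This file proves:

* §1 `degenerateLocusA2_of_betaExit : S_β2 → S_β3 → Theses.SlopeDichotomyA2.DegenerateLocusA2` (two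
  lines) and `typeBRankOneUnridered_of_betaExit_of_five` (the rung-I1 leaf from S_β2, S_β3 and the
  FIVE named published facts of `PublishedInputsA2`, through the route's `closes`).
* §2 NON-VACUITY of the rider on corner A2 — all its data short of the order clause EXIST:
  `isOrdinaryAt_of_typeBRankOne` (anomalous ⇒ ordinary); `criticalRoot_spec` (`β = p/α`,
  `α = unitRoot W p` by Hensel, PROVED `unitRoot_spec_holds`: `β² − a_p β + p = 0`, `v_p(β) = 1`,
  `a_p = W.LFunction p` by `LFunction_apply_prime_eq_frobeniusTrace`);
  `exists_isEigenLift_of_typeBRankOne`: modularity (`nonempty_modularParametrizationData`, named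
  fact, via the PROVED bridge `exists_isNewformOf_of_nonempty_modularParametrizationData`), the
  level prime to `p` (`not_dvd_level_of_isNewformOf`), `p ≠ 2`, and the Pollack–Stevens 2013 Galois
  door `pollackStevens2013_eigenLiftFull_of_not_isLocallySplitAt` (named fact) at a pair that is NOT
  locally split give a newform `f`, the critical root `β` and an eigen-lift `Φ_β`.
* §3 the rider in CERTIFICATE form: on corner A2 the constant term of `L_p(Φ_β, β; T)` VANISHES for
  every newform/critical root/eigen-lift (`constantCoeff_criticalSlopePAdicLFunction_eq_zero_of_typeBRankOne`:
  `r_an = 1` ⇒ `L(E,1) = 0` ⇒ `[0]⁺_f = 0`, with D1's interpolation theorem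
  `constantCoeff_criticalSlopePAdicLFunction_of_isEigenLift`), hence
  `order = 1 ↔ [T¹] ≠ 0` (`order_criticalSlopePAdicLFunction_eq_one_iff_of_typeBRankOne`) and
  `hasBetaOrderOne_of_coeff_one_ne_zero` — the β-analogue of the α-certificate
  "`[T¹] L_p(f,α,T) ≠ 0 ⟺ Schneider`" (`DegenerateLocusA2PrintPlacement`, `RankOneCoeffTwoCertificate`).

Ledger reading: with S_β2/S_β3 registered as the stubs of item 19086, the crux is CLOSED MODULO two
statements whose printed content is {Büyükboduk–Pollack–Sasaki arXiv:1811.08216 Cor. 1.1.2 (β-Gross–Zagier,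
no irreducibility hypothesis; preprint resting on Kobayashi's higher-weight non-ordinary GZ),
Hansen arXiv:1508.03982 Thm. 1.2.1 (Perrin-Riou's β-coordinate = Pollack–Stevens' `L_p(f_β)`; preprint)}
plus PUBLISHED theorems (Greenberg–Vatsal 2000, Kato 2004, Perrin-Riou 1993 §3.3.7/3.4.4/3.4.6,
Colmez 1998, GZK, Gross–Zagier 1986, Mazur 1978) — see the docstrings of the Defs file and the memo
`run/shared/lean/pub/bsd-schneider-ideate/memos/i1-c2/TENURE-SlopeDichotomyA2-g11.md` §§2–3.

References: [PollackStevens2011] Def. 6.4, Prop. 6.5, §9.1; [PollackStevens2013];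
[BuyukbodukPollackSasaki2018] Cor. 1.1.2, Thm. 6.1.2, §6.2; [PerrinRiou1993AIF] 3.3.7, 3.4.4, 3.4.6;
[Hansen2016CriticalPadicL] Thm. 1.2.1; [MazurTateTeitelbaum1986Invent] §I.11, §I.14.
-/

set_option autoImplicit false
-- the Theorems namespace of a single-conjunct summit repeats the summit name by design (D-0017)
set_option linter.dupNamespace false

noncomputable section

open scoped Classical MatrixGroups

namespace Summit.BirchSwinnertonDyer.BirchSwinnertonDyer.Theorems.SlopeDichotomyA2BetaExit

open WeierstrassCurve CongruenceSubgroup Literature.NumberTheory.EllipticCurves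
  Literature.NumberTheory.EllipticCurves.ModularForms
  Literature.NumberTheory.EllipticCurves.OMSWeightTwo
  Literature.NumberTheory.EllipticCurves.Rank1Residual
  Summit.BirchSwinnertonDyer.Rank1Residual
  Summit.BirchSwinnertonDyer.BirchSwinnertonDyer.Theses
  Summit.BirchSwinnertonDyer.BirchSwinnertonDyer.Theorems

/-! ## §1 The composition: crux and leaf from the β-exit -/

/-- **Crux `DegenerateLocusA2` (item stmt-BirchSwinnertonDyer-19086) from the β-exit**: S_β2
(`BetaOrderOneOnDegenerateA2`: on the α-degenerate A2 pairs the critical-slope `L`-function has a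
simple zero) and S_β3 (`BSDpOfBetaOrderOneA2`: on A2 a simple zero of `L_p(f_β,T)` gives `BSD(E,p)`)
imply the route decl BY NAME.  Conditional result (two open statements); credits nothing.
[cite: BuyukbodukPollackSasaki2018, Cor. 1.1.2 and §6.2] -/
theorem degenerateLocusA2_of_betaExit (h2 : BetaOrderOneOnDegenerateA2) (h3 : BSDpOfBetaOrderOneA2) :
    SlopeDichotomyA2.DegenerateLocusA2 :=
  fun W _ _ p _ hB hdeg ↦ h3 W p hB (h2 W p hB hdeg)

/-- **The rung-I1 leaf from the β-exit and the five published inputs**: S_β2 + S_β3 give the crux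
(`degenerateLocusA2_of_betaExit`), and the route's deciding theorem with the Mazur–Tate `σ`-input
discharged by the tree theorem `mazur_tate_sigma_exists_odd_holds` (`Theses.SlopeDichotomyA2.closes`;
Greenberg–Vatsal, Schneider 1985, Perrin-Riou 1987, modularity, GZK by name) gives
`SchneiderWeaken.TypeBRankOneUnridered`.  Conditional result; credits nothing.
[cite: GreenbergVatsal2000, Thm. (1.3)] -/
theorem typeBRankOneUnridered_of_betaExit_of_five (h2 : BetaOrderOneOnDegenerateA2)
    (h3 : BSDpOfBetaOrderOneA2)
    (hGV : GreenbergVatsal2000.thm13_charIdeal_eq_of_gvPar)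
    (hS : Schneider1985_order_charGenerator_odd) (hPR : perrinRiou_rankOne_leadingTerms_odd)
    (hmod : nonempty_modularParametrizationData)
    (hGZK : rank_eq_analyticRank_of_analyticRank_le_one) :
    SchneiderWeaken.TypeBRankOneUnridered :=
  SlopeDichotomyA2.closes (degenerateLocusA2_of_betaExit h2 h3)
    ⟨hGV, hS, hPR, mazur_tate_sigma_exists_odd_holds, hmod, hGZK⟩

/-! ## §2 Non-vacuity of the β-rider on corner A2: ordinary, the critical root, the eigen-lift -/

variable {p : ℕ} [Fact p.Prime]

/-- **A corner-A2 prime is good ORDINARY**: `X1.TypeBRankOne W p` contains `ClassX1 W p`, i.e.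
good reduction and `a_p ≡ 1 (mod p)`, whence `p ∤ a_p` (`IsClassX1.not_dvd_frobeniusTrace`).
[cite: MazurTateTeitelbaum1986Invent, §I.11] -/
theorem isOrdinaryAt_of_typeBRankOne {W : WeierstrassCurve ℚ} [W.IsElliptic] [W.IsGloballyMinimal]
    (hB : X1.TypeBRankOne W p) : IsOrdinaryAt W p :=
  have hX := isClassX1_of_classX1 hB.1
  ⟨hX.hasGoodReductionAtPrime, hX.not_dvd_frobeniusTrace⟩

/-- **The critical-slope root `β = p/α`** at a good ordinary prime: with `α = unitRoot W p` (Hensel,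
PROVED `unitRoot_spec_holds`: `α² − a_p α + p = 0`, `|α|_p = 1`), `β := p/α ∈ ℚ_p` satisfies
`β² − a_p β + p = 0` with `a_p = W.LFunction p` (`LFunction_apply_prime_eq_frobeniusTrace` at a good
prime) and has valuation `v_p(β) = 1` (`|β|_p = |p|_p/|α|_p = p⁻¹`).
[cite: MazurTateTeitelbaum1986Invent, §I.11 (the two roots `α`, `p/α`)] -/
theorem criticalRoot_spec {W : WeierstrassCurve ℚ} [W.IsElliptic] [W.IsGloballyMinimal]
    (hord : IsOrdinaryAt W p) :
    ((p : ℚ_[p]) / (unitRoot W p : ℚ_[p])) ^ 2 -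
        (W.LFunction p : ℚ_[p]) * ((p : ℚ_[p]) / (unitRoot W p : ℚ_[p])) + p = 0 ∧
      Padic.valuation ((p : ℚ_[p]) / (unitRoot W p : ℚ_[p])) = 1 := by
  obtain ⟨hαeq, hαnorm, hα0⟩ := unitRoot_coe_spec (W := W) hord
  have hL : (W.LFunction p : ℚ_[p]) = ((W.frobeniusTrace p : ℤ) : ℚ_[p]) := by
    rw [WeierstrassCurve.LFunction_apply_prime_eq_frobeniusTrace W p hord.1]
  set α : ℚ_[p] := (unitRoot W p : ℚ_[p]) with hαdef
  have hp0 : (p : ℚ_[p]) ≠ 0 := by exact_mod_cast (Fact.out : p.Prime).ne_zero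
  refine ⟨?_, ?_⟩
  · rw [hL]
    have : ((p : ℚ_[p]) / α) ^ 2 - ((W.frobeniusTrace p : ℤ) : ℚ_[p]) * ((p : ℚ_[p]) / α) + p
        = ((p : ℚ_[p]) / α ^ 2) * (α ^ 2 - ((W.frobeniusTrace p : ℤ) : ℚ_[p]) * α + p) := by
      field_simp
      ring
    rw [this, hαeq, mul_zero]
  · have hβ0 : (p : ℚ_[p]) / α ≠ 0 := div_ne_zero hp0 hα0
    have hnorm : ‖(p : ℚ_[p]) / α‖ = (p : ℝ) ^ (-(1 : ℤ)) := by
      rw [norm_div, hαnorm, div_one, Padic.norm_p, zpow_neg, zpow_one]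
    have h := Padic.norm_eq_zpow_neg_valuation hβ0
    rw [hnorm] at h
    have hp1 : 1 < (p : ℝ) := by exact_mod_cast (Fact.out : p.Prime).one_lt
    have := zpow_right_injective₀ (by positivity) hp1.ne' h
    omega

/-- **The data of the β-rider EXIST on corner A2 (short of the order clause)**, modulo modularity
and the Pollack–Stevens eigen-lift at a non-locally-split pair: for `X1.TypeBRankOne W p` with
`V_pE|_{G_{ℚ_p}}` NOT split (`¬ IsLocallySplitAt W p` — expected for every non-CM curve, Greenberg's
question; the degenerate locus is non-CM by Bertrand), there are a newform `f` of `W` (modularity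
`nonempty_modularParametrizationData` BY NAME through the proved bridge
`exists_isNewformOf_of_nonempty_modularParametrizationData`; its level is prime to the good prime `p`,
`not_dvd_level_of_isNewformOf`), the critical root `β = p/α` (`criticalRoot_spec`) and a Hecke
eigen-lift `Φ_β` of `φ_β` (`pollackStevens2013_eigenLiftFull_of_not_isLocallySplitAt` BY NAME:
`p ≠ 2` from `2 < p`, `p ∤ N`, `p ∤ a_p`, `v_p(β) = 1`). So `HasBetaOrderOne W p` reads
"`ord_{T=0} L_p(Φ_β, β; T) = 1`" for THE lift. [cite: PollackStevens2013, Thm. 1.2 / PS2011 Thm. 5.14 and Def. 6.4]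
[cite: BreuilConradDiamondTaylor2001, Thm. A] -/
theorem exists_isEigenLift_of_typeBRankOne (hmod : nonempty_modularParametrizationData)
    (hPS : pollackStevens2013_eigenLiftFull_of_not_isLocallySplitAt)
    {W : WeierstrassCurve ℚ} [W.IsElliptic] [W.IsGloballyMinimal] (hB : X1.TypeBRankOne W p)
    (hns : ¬ IsLocallySplitAt W p) :
    ∃ (N : ℕ) (_ : NeZero N) (f : CuspForm (Gamma0 N) 2) (β : ℚ_[p]) (Φ : OMSymb p (N * p)),
      IsNewformOf W f ∧ β ^ 2 - (W.LFunction p : ℚ_[p]) * β + p = 0 ∧ Padic.valuation β = 1 ∧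
        IsEigenLift W f β Φ := by
  have hord : IsOrdinaryAt W p := isOrdinaryAt_of_typeBRankOne hB
  haveI : NeZero (W.conductorNorm ℤ) := ⟨(WeierstrassCurve.conductorNorm_pos_holds W).ne'⟩
  obtain ⟨f, hf⟩ := exists_isNewformOf_of_nonempty_modularParametrizationData hmod W
  have hpN : ¬ p ∣ W.conductorNorm ℤ := not_dvd_level_of_isNewformOf hf hord.1
  have hp2 : p ≠ 2 := by have := hB.1.1; omega
  have hap : ¬ (p : ℤ) ∣ W.LFunction p := by
    rw [WeierstrassCurve.LFunction_apply_prime_eq_frobeniusTrace W p hord.1]; exact hord.2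
  obtain ⟨hβeq, hβval⟩ := criticalRoot_spec (W := W) hord
  obtain ⟨Φ, hΦ, -⟩ := hPS p W f hf hp2 hpN hap _ hβeq hβval hns
  exact ⟨_, inferInstance, f, _, Φ, hf, hβeq, hβval, hΦ.isEigenLift⟩

/-! ## §3 The rider in certificate form: `[T⁰] = 0` on A2, so `order = 1 ↔ [T¹] ≠ 0` -/

/-- **On corner A2 the constant term of the critical-slope `L`-function vanishes** — for every
newform `f` of `W`, critical root `β` and eigen-lift `Φ_β`: D1's interpolation at the trivial
character `L_p(Φ_β, β; 0) = (1 − β⁻¹)² [0]⁺_f` (`constantCoeff_criticalSlopePAdicLFunction_of_isEigenLift`,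
Pollack–Stevens Prop. 6.5) and `[0]⁺_f = L(E,1)/Ω⁺_f = 0` since `ord_{s=1} L(E,s) = 1`
(`analyticRank_eq_zero_iff_holds`, `IsNewformOf.ratPlusSymbol_zero_mul_plusPeriod`, `Ω⁺_f > 0`).
Tree theorems only. [cite: PollackStevens2011, Prop. 6.5 (p. 31)] [cite: MazurTateTeitelbaum1986Invent, §I.14 (14.3)] -/
theorem constantCoeff_criticalSlopePAdicLFunction_eq_zero_of_typeBRankOne
    {W : WeierstrassCurve ℚ} [W.IsElliptic] [W.IsGloballyMinimal] (hB : X1.TypeBRankOne W p)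
    {N : ℕ} [NeZero N] {f : CuspForm (Gamma0 N) 2} (hf : IsNewformOf W f) {β : ℚ_[p]}
    (hβ : β ^ 2 - (W.LFunction p : ℚ_[p]) * β + p = 0) (hβ1 : Padic.valuation β = 1)
    {Φ : OMSymb p (N * p)} (hΦ : IsEigenLift W f β Φ) :
    PowerSeries.constantCoeff (criticalSlopePAdicLFunction Φ β) = 0 := by
  have hord : IsOrdinaryAt W p := isOrdinaryAt_of_typeBRankOne hB
  have hpN : ¬ p ∣ N := not_dvd_level_of_isNewformOf hf hord.1
  have hβ0 : β ≠ 0 := by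
    intro h
    rw [h, Padic.valuation_zero] at hβ1
    exact zero_ne_one hβ1
  rw [constantCoeff_criticalSlopePAdicLFunction_of_isEigenLift hf hpN hβ0 hβ hΦ]
  have hne : W.analyticRank ≠ 0 := by rw [hB.2.1]; exact one_ne_zero
  have hE : W.HasEntireLFunction := W.hasEntireLFunction_of_analyticRank_ne_zero hne
  have hL : W.entireLFunction 1 = 0 := by
    by_contra hL
    exact hne ((WeierstrassCurve.analyticRank_eq_zero_iff_holds (W := W) hE).mpr hL)
  have hpos : 0 < plusPeriod f := IsNewform0.plusPeriod_pos_holds hf.1 hf.coeffField_eq_bot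
  have hsym : ratPlusSymbol f 0 = 0 := by
    have h1 := hf.ratPlusSymbol_zero_mul_plusPeriod
    rw [hL, Complex.zero_re] at h1
    have h2 : ((ratPlusSymbol f 0 : ℚ) : ℝ) = 0 := (mul_eq_zero.mp h1).resolve_right hpos.ne'
    exact_mod_cast h2
  rw [hsym, Rat.cast_zero, mul_zero]

/-- **On corner A2, `ord_{T=0} L_p(Φ_β, β; T) = 1 ↔ [T¹] L_p(Φ_β, β; T) ≠ 0`** (the constant term
vanishes by `constantCoeff_criticalSlopePAdicLFunction_eq_zero_of_typeBRankOne`; `PowerSeries.order_eq_nat`).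
The β-rider is thus a ONE-NUMBER certificate, like the α-rider's `[T¹] L_p(f,α,T) ≠ 0`.
[cite: PollackStevens2011, §9.1 (p. 41)] -/
theorem order_criticalSlopePAdicLFunction_eq_one_iff_of_typeBRankOne
    {W : WeierstrassCurve ℚ} [W.IsElliptic] [W.IsGloballyMinimal] (hB : X1.TypeBRankOne W p)
    {N : ℕ} [NeZero N] {f : CuspForm (Gamma0 N) 2} (hf : IsNewformOf W f) {β : ℚ_[p]}
    (hβ : β ^ 2 - (W.LFunction p : ℚ_[p]) * β + p = 0) (hβ1 : Padic.valuation β = 1)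
    {Φ : OMSymb p (N * p)} (hΦ : IsEigenLift W f β Φ) :
    (criticalSlopePAdicLFunction Φ β).order = 1 ↔
      PowerSeries.coeff 1 (criticalSlopePAdicLFunction Φ β) ≠ 0 := by
  have h0 := constantCoeff_criticalSlopePAdicLFunction_eq_zero_of_typeBRankOne hB hf hβ hβ1 hΦ
  have h1 : ((1 : ℕ) : ℕ∞) = 1 := Nat.cast_one
  rw [← h1, PowerSeries.order_eq_nat]
  constructor
  · exact fun h ↦ h.1
  · intro h
    refine ⟨h, fun i hi ↦ ?_⟩
    have : i = 0 := by omega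
    subst this
    rwa [PowerSeries.coeff_zero_eq_constantCoeff]

/-- **The β-rider from the one-number certificate**: on corner A2, a newform `f`, critical root `β`,
eigen-lift `Φ_β` and `[T¹] L_p(Φ_β, β; T) ≠ 0` give `HasBetaOrderOne W p`.
[cite: PollackStevens2011, Def. 6.4 (p. 31) and §9.1 (p. 41)] -/
theorem hasBetaOrderOne_of_coeff_one_ne_zero
    {W : WeierstrassCurve ℚ} [W.IsElliptic] [W.IsGloballyMinimal] (hB : X1.TypeBRankOne W p)
    {N : ℕ} [NeZero N] {f : CuspForm (Gamma0 N) 2} (hf : IsNewformOf W f) {β : ℚ_[p]}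
    (hβ : β ^ 2 - (W.LFunction p : ℚ_[p]) * β + p = 0) (hβ1 : Padic.valuation β = 1)
    {Φ : OMSymb p (N * p)} (hΦ : IsEigenLift W f β Φ)
    (h1 : PowerSeries.coeff 1 (criticalSlopePAdicLFunction Φ β) ≠ 0) : HasBetaOrderOne W p :=
  ⟨N, inferInstance, f, β, Φ, hf, hβ, hβ1, hΦ,
    (order_criticalSlopePAdicLFunction_eq_one_iff_of_typeBRankOne hB hf hβ hβ1 hΦ).2 h1⟩

/-- **The β-road's hypothesis at a non-locally-split A2 pair is exactly one number**: granted
modularity and the Pollack–Stevens Galois door, `HasBetaOrderOne W p` holds as soon as the linear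
coefficient of `L_p(Φ_β, β; T)` is non-zero for SOME (equivalently, by `IsEigenLift.unique`, THE)
eigen-lift — the statement a critical-slope engine would certify per pair (falsifier K-β1 of the
tenure memo). [cite: PollackStevens2011, §9.4 (pp. 43–46): the computed critical-slope zeros] -/
theorem hasBetaOrderOne_of_forall_coeff_one_ne_zero (hmod : nonempty_modularParametrizationData)
    (hPS : pollackStevens2013_eigenLiftFull_of_not_isLocallySplitAt)
    {W : WeierstrassCurve ℚ} [W.IsElliptic] [W.IsGloballyMinimal] (hB : X1.TypeBRankOne W p)
    (hns : ¬ IsLocallySplitAt W p)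
    (h1 : ∀ {N : ℕ} [NeZero N] (f : CuspForm (Gamma0 N) 2) (β : ℚ_[p]) (Φ : OMSymb p (N * p)),
      IsNewformOf W f → β ^ 2 - (W.LFunction p : ℚ_[p]) * β + p = 0 → Padic.valuation β = 1 →
        IsEigenLift W f β Φ → PowerSeries.coeff 1 (criticalSlopePAdicLFunction Φ β) ≠ 0) :
    HasBetaOrderOne W p := by
  obtain ⟨N, _, f, β, Φ, hf, hβ, hβ1, hΦ⟩ := exists_isEigenLift_of_typeBRankOne hmod hPS hB hns
  exact hasBetaOrderOne_of_coeff_one_ne_zero hB hf hβ hβ1 hΦ (h1 f β Φ hf hβ hβ1 hΦ)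

end Summit.BirchSwinnertonDyer.BirchSwinnertonDyer.Theorems.SlopeDichotomyA2BetaExit

end
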